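import Summits.QuantumFields.YangMills.Theorems.BalabanLadderNTReferencePackageScales
import Summits.QuantumFields.YangMills.Theorems.BalabanLadderNTBoundaryLawOscillation
import HarnessLib

/-!
# Crux `NT` (stmt-QuantumFields-19353): reference-state transfer, XV — the one-point ceiling (E1-osc) IS the femto
# boundary law `FBL` (up to constants)

Helper file (`--supports stmt-QuantumFields-19353`) of the fleet lead prover of crux `NT` (unit `ym-spine-19353-p1`,
g4).  Places the first engine item of the reference currency (ENGINE-TARGET v4, evidence #41) against the packages of
record: the exterior-OSCILLATION ceiling (E1-osc) `|kerE^η(dens x) − kerE^{η'}(dens x)| ≤ C₁/d⁴` (depth `d ≥ 1`, femto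
cubes) and the registered femto boundary law `FBL G r a` (`|kerE^η(dens x) − p β| ≤ C₁/d⁴`, depth `≥ 2`, SOME reference
value `p β`; `Theorems/LangevinControlUVOSLegsFromFemtoAndGapDefs.lean`) imply each other:

* `fbl_of_e1osc` — (E1-osc) ⇒ `FBL` (through `BoundaryLaw.fbl_of_oscillation`: the reference value is manufactured by
  DLR averaging; the origin of `[-R, R]⁴` has depth `R + 1`);
* `e1osc_of_fbl` — `FBL` ⇒ (E1-osc) with constant `max (2 C₁) (2 M)` (`M` = a bound of the action density; the depth-1
  layer is covered by the trivial bound).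

So E1-osc is already on every bill (v2/v3 `FBL`), and the reference currency's genuinely new ceilings are E2-osc / E3-osc.
-/

set_option autoImplicit false

noncomputable section

open MeasureTheory Filter Topology
open Literature.MathematicalPhysics.QuantumFieldTheory Literature.MathematicalPhysics.QuantumLattice
open Literature.Probability.LatticeModels
open Summit.QuantumFields.YangMills.Cruxes.OSLegsFromFemtoAndGap.DlrCollarTransfer
open Summit.QuantumFields.YangMills.Cruxes.OSLegsFromFemtoAndGap.DlrCollarTransfer.StubLower (exists_abs_dens_le)
open Summit.QuantumFields.YangMills.Cruxes.NT.BoundaryLaw (fbl_of_oscillation abs_kerE_le)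

namespace Summit.QuantumFields.YangMills.Cruxes.NT.Reference

variable (G : Type) [Group G] [TopologicalSpace G] [IsTopologicalGroup G] [CompactSpace G]
  [MeasurableSpace G] [BorelSpace G] (r : LatticeRep G)

/-- **(E1-osc) ⇒ `FBL`.**  If on femto cubes (`b · a β ≤ ℓ`, `β ≥ β₁`) the kernel mean of the action density at every
site of depth `d ≥ 1` oscillates over exteriors by at most `C₁ / d⁴` (`C₁ ≥ 0`, `ℓ > 0`, `a > 0`), then the registered
femto boundary law `FBL G r a` holds. [folklore] -/
theorem fbl_of_e1osc (a : ℝ → ℝ) (ha₀ : ∀ β, 0 < a β) {C₁ ℓ : ℝ} (hC₁ : 0 ≤ C₁) (hℓ : 0 < ℓ)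
    (hE1 : ∃ β₁ : ℝ, ∀ β : ℝ, β₁ ≤ β → ∀ (c : Fin 4 → ℤ) (b : ℕ), (b : ℝ) * a β ≤ ℓ →
      ∀ (η η' : LGConfig 4 G) (x : Fin 4 → ℤ), 1 ≤ depth c b x →
        |kerE G r β c b η (dens G r x) - kerE G r β c b η' (dens G r x)| ≤ C₁ / (depth c b x : ℝ) ^ 4) :
    FBL G r a := by
  obtain ⟨β₁, H⟩ := hE1
  refine fbl_of_oscillation G r a ha₀ 0 ⟨C₁, β₁, ℓ, hℓ, fun β hβ R _ hRa η η' => ?_⟩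
  have hd : (R : ℝ) + 1 ≤ (depth (fun _ => -(R : ℤ)) (2 * R + 1) 0 : ℝ) := by
    have := le_depth_origin (0 : Fin 4 → ℤ) R (t := 0) (fun j => by simp)
    simpa using this
  have hd1 : 1 ≤ depth (fun _ => -(R : ℤ)) (2 * R + 1) 0 := by
    have hR0 : (0 : ℝ) ≤ (R : ℝ) := Nat.cast_nonneg R
    have : (1 : ℝ) ≤ (depth (fun _ => -(R : ℤ)) (2 * R + 1) 0 : ℝ) := by linarith
    exact_mod_cast this
  refine (H β hβ _ _ hRa η η' 0 hd1).trans ?_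
  have hR : (0 : ℝ) < (R : ℝ) + 1 := by positivity
  exact div_le_div_of_nonneg_left hC₁ (pow_pos hR 4) (pow_le_pow_left₀ hR.le hd 4)

/-- **`FBL` ⇒ (E1-osc).**  The registered femto boundary law (depth `≥ 2`, reference value `p β`) gives the
exterior-oscillation ceiling at every site of depth `≥ 1` with constant `max (2 C₁) (2 M)`, `M` a bound of the action
density (depth `≥ 2`: triangle inequality through `p β`; depth `1`: the trivial bound `2M`). [folklore] -/
theorem e1osc_of_fbl (a : ℝ → ℝ) (hF : FBL G r a) :
    ∃ (C₁ ℓ : ℝ), 0 ≤ C₁ ∧ 0 < ℓ ∧ ∃ β₁ : ℝ, ∀ β : ℝ, β₁ ≤ β → ∀ (c : Fin 4 → ℤ) (b : ℕ), (b : ℝ) * a β ≤ ℓ →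
      ∀ (η η' : LGConfig 4 G) (x : Fin 4 → ℤ), 1 ≤ depth c b x →
        |kerE G r β c b η (dens G r x) - kerE G r β c b η' (dens G r x)| ≤ C₁ / (depth c b x : ℝ) ^ 4 := by
  obtain ⟨C₁, β₁, ℓ₁, p, hℓ₁, hC₁, H⟩ := hF
  obtain ⟨M, hM0, hM⟩ := exists_abs_dens_le G r
  refine ⟨max (2 * C₁) (2 * M), ℓ₁, le_trans (by linarith) (le_max_left _ _), hℓ₁, β₁,
    fun β hβ c b hb η η' x hx => ?_⟩
  have hdpos : (0 : ℝ) < (depth c b x : ℝ) := by exact_mod_cast hx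
  rcases Nat.lt_or_ge (depth c b x) 2 with hlt | hge
  · -- depth 1: trivial bound
    have hd1 : depth c b x = 1 := by omega
    have h1 := abs_kerE_le G r β c b η (F := dens G r x) (hM x)
    have h2 := abs_kerE_le G r β c b η' (F := dens G r x) (hM x)
    rw [hd1]
    push_cast
    rw [one_pow, div_one]
    calc |kerE G r β c b η (dens G r x) - kerE G r β c b η' (dens G r x)|
        ≤ |kerE G r β c b η (dens G r x)| + |kerE G r β c b η' (dens G r x)| := abs_sub _ _
      _ ≤ 2 * M := by linarith
      _ ≤ max (2 * C₁) (2 * M) := le_max_right _ _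
  · have h1 := H β hβ c b hb η x hge
    have h2 := H β hβ c b hb η' x hge
    have hd4 : (0 : ℝ) < (depth c b x : ℝ) ^ 4 := by positivity
    calc |kerE G r β c b η (dens G r x) - kerE G r β c b η' (dens G r x)|
        ≤ |kerE G r β c b η (dens G r x) - p β| + |p β - kerE G r β c b η' (dens G r x)| := abs_sub_le _ _ _
      _ = |kerE G r β c b η (dens G r x) - p β| + |kerE G r β c b η' (dens G r x) - p β| := by
          rw [abs_sub_comm (p β)]
      _ ≤ C₁ / (depth c b x : ℝ) ^ 4 + C₁ / (depth c b x : ℝ) ^ 4 := add_le_add h1 h2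
      _ = (2 * C₁) / (depth c b x : ℝ) ^ 4 := by ring
      _ ≤ max (2 * C₁) (2 * M) / (depth c b x : ℝ) ^ 4 :=
          div_le_div_of_nonneg_right (le_max_left _ _) hd4.le

end Summit.QuantumFields.YangMills.Cruxes.NT.Reference

end
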